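import Summits.BirchSwinnertonDyer.BirchSwinnertonDyer.Theorems.ManinLocalTwoThreeLigozatIdentitiesTwentySeven
import HarnessLib

/-!
# The Euler functions at level 32: `E₄ = 1 − q⁴ + o(q⁷)`, `E₄′ = −8πi q⁴ + o(q⁷)`;
# `X₃₂`, `Y₃₂`, `φ₃₂` as `q`-monomials times Euler functions; the derivatives of `X₃₂`, `Y₃₂`

Cell bsd-f2-manin, route `ManinLocalTwoThree`; the level-`32` twin of `ManinLocalTwoThreeEulerRemaindersTwentySeven`
(toolkit for the three limits (T1)₃₂–(T3)₃₂ of `EtaIdentityReductionThirtyTwo`).  With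
`E_δ(τ) = ∏_{n ≥ 1} (1 − q^{δn})` (`eulerFn δ`), `q = e^{2πiτ}`, in the remainder language of
`ManinLocalTwoThreeQRemainderCalculus`:

* `E₄ = 1 − q⁴ + o(q⁷)` and `E₄′ = 2πi(−4q⁴) + o(q⁷)` (`tendsto_eulerFn_four`, `tendsto_deriv_eulerFn_four`);
  `E₈, E₁₆, E₃₂ = 1 + o(q⁷)` and `E₈′, E₁₆′, E₃₂′ = o(q⁷)` are `EulerRemainders.tendsto_eulerFn` /
  `tendsto_deriv_eulerFn`;
* `X₃₂ = η(16τ)⁶/(η(8τ)²η(32τ)⁴) = E₁₆⁶/(q²E₈²E₃₂⁴)`, `Y₃₂ = η(8τ)⁴η(16τ)²/(η(4τ)²η(32τ)⁴) = E₈⁴E₁₆²/(q³E₄²E₃₂⁴)`,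
  `φ₃₂ = η(4τ)²η(8τ)² = q E₄²E₈²` (`X32_eq`, `Y32_eq`, `etaProductThirtyTwo_eq`);
* the logarithmic derivatives `deriv_X32`, `deriv_Y32`.
-/

set_option autoImplicit false
set_option linter.dupNamespace false

noncomputable section

open Complex Filter Topology Set Asymptotics Polynomial
open UpperHalfPlane hiding I
open scoped Real Topology Manifold MatrixGroups
open Literature.NumberTheory.EllipticCurves Literature.NumberTheory.EllipticCurves.ModularForms

namespace Summit.BirchSwinnertonDyer.BirchSwinnertonDyer.Theorems.ManinLocalTwoThree.EulerRemaindersThirtyTwo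

open QRemainder EulerRemainders
open LigozatIdentities (hasDerivAt_eulerFn_comp)

/-! ## 1. `E₄ = 1 − q⁴ + o(q⁷)` and `E₄′ = 2πi(−4q⁴) + o(q⁷)` -/

/-- The first eight `q`-coefficients of `E₄`: `1, 0, 0, 0, −1, 0, 0, 0`. [folklore] -/
theorem coeff_formalEulerScaled_four (n : ℕ) (hn : n ≤ 7) :
    PowerSeries.coeff n (formalEulerScaled 4) = if n = 0 then 1 else if n = 4 then -1 else 0 := by
  obtain ⟨h0, h1, -⟩ := coeff_formalEulerPow_one_of_le_two
  interval_cases n <;> simp +decide [coeff_formalEulerScaled, h0, h1]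

/-- **`E₄ = 1 − q⁴ + o(q⁷)`.** [folklore] -/
theorem tendsto_eulerFn_four :
    Tendsto (fun τ : ℍ ↦ (eulerFn 4 τ - (1 - X ^ 4 : ℂ[X]).eval (Function.Periodic.qParam 1 (τ : ℂ)))
      / Function.Periodic.qParam 1 (τ : ℂ) ^ 7) atImInfty (𝓝 0) := by
  refine congr_poly ?_ (tendsto_of_hasSum (periodic_eulerFn 4) (mdifferentiable_eulerFn 4)
    (isBoundedAtImInfty_eulerFn (by norm_num)) (hasSum_eulerFn (by norm_num)) 7)
  have h := coeff_formalEulerScaled_four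
  simp only [Finset.sum_range_succ, Finset.sum_range_zero, h 0 (by norm_num), h 1 (by norm_num),
    h 2 (by norm_num), h 3 (by norm_num), h 4 (by norm_num), h 5 (by norm_num), h 6 (by norm_num),
    h 7 (by norm_num)]
  norm_num
  ring

/-- **`E₄′ = 2πi(−4q⁴) + o(q⁷)`.** [folklore] -/
theorem tendsto_deriv_eulerFn_four :
    Tendsto (fun τ : ℍ ↦ (deriv (eulerFn 4 ∘ ofComplex) τ
      - (C (2 * π * I) * (-4 * X ^ 4) : ℂ[X]).eval (Function.Periodic.qParam 1 (τ : ℂ)))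
      / Function.Periodic.qParam 1 (τ : ℂ) ^ 7) atImInfty (𝓝 0) := by
  refine congr_poly ?_ (congr_fun (fun τ ↦ deriv_eulerFn_sub_one 4 τ)
    (tendsto_deriv_of_isCuspFunction (isCuspFunction_eulerFn_sub_one (by norm_num : 0 < 4)) 7))
  have h := coeff_formalEulerScaled_four
  have hc : ∀ n : ℕ, n ≠ 0 → n ≤ 7 → (qExpansion 1 (eulerFn 4 - 1)).coeff n
      = (((if n = 0 then 1 else if n = 4 then -1 else 0 : ℤ)) : ℂ) :=
    fun n hn hn7 ↦ by rw [qExpansion_eulerFn_sub_one_coeff_of_ne_zero (by norm_num) hn, h n hn7]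
  simp only [Finset.sum_range_succ, Finset.sum_range_zero, hc 1 one_ne_zero (by norm_num),
    hc 2 (by norm_num) (by norm_num), hc 3 (by norm_num) (by norm_num), hc 4 (by norm_num) (by norm_num),
    hc 5 (by norm_num) (by norm_num), hc 6 (by norm_num) (by norm_num), hc 7 (by norm_num) (by norm_num)]
  norm_num
  simp only [map_ofNat]
  ring

/-! ## 2. `X₃₂`, `Y₃₂`, `φ₃₂` in terms of `q` and the Euler functions -/

/-- **`X₃₂ = η(16τ)⁶/(η(8τ)²η(32τ)⁴) = E₁₆⁶/(q² E₈² E₃₂⁴)`.** [folklore] -/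
theorem X32_eq (τ : ℍ) :
    etaQuotient 32 (expFn [(8, -2), (16, 6), (32, -4)]) τ
      = eulerFn 16 τ ^ 6 / (Function.Periodic.qParam 1 (τ : ℂ) ^ 2 * eulerFn 8 τ ^ 2 * eulerFn 32 τ ^ 4) := by
  have hE8 := eulerFn_ne_zero (by norm_num : 0 < 8) τ
  have hE32 := eulerFn_ne_zero (by norm_num : 0 < 32) τ
  have hq := qParam_ne_zero τ
  rw [etaQuotient_eq_cexp_mul_prod, show Nat.divisors 32 = {1, 2, 4, 8, 16, 32} by decide]
  have hsum : (∑ δ ∈ ({1, 2, 4, 8, 16, 32} : Finset ℕ), (δ : ℤ) * expFn [(8, -2), (16, 6), (32, -4)] δ)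
      = (-(24 * 2 : ℕ) : ℤ) := by decide
  rw [hsum, cexp_neg_eq_inv_qParam_pow]
  rw [Finset.prod_insert (by decide), Finset.prod_insert (by decide), Finset.prod_insert (by decide),
    Finset.prod_insert (by decide), Finset.prod_insert (by decide), Finset.prod_singleton]
  rw [show expFn [(8, -2), (16, 6), (32, -4)] 1 = 0 by decide,
    show expFn [(8, -2), (16, 6), (32, -4)] 2 = 0 by decide,
    show expFn [(8, -2), (16, 6), (32, -4)] 4 = 0 by decide,
    show expFn [(8, -2), (16, 6), (32, -4)] 8 = -2 by decide,
    show expFn [(8, -2), (16, 6), (32, -4)] 16 = 6 by decide,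
    show expFn [(8, -2), (16, 6), (32, -4)] 32 = -4 by decide]
  simp only [zpow_neg, zpow_ofNat]
  field_simp

/-- **`Y₃₂ = η(8τ)⁴η(16τ)²/(η(4τ)²η(32τ)⁴) = E₈⁴E₁₆²/(q³ E₄² E₃₂⁴)`.** [folklore] -/
theorem Y32_eq (τ : ℍ) :
    etaQuotient 32 (expFn [(4, -2), (8, 4), (16, 2), (32, -4)]) τ
      = eulerFn 8 τ ^ 4 * eulerFn 16 τ ^ 2
        / (Function.Periodic.qParam 1 (τ : ℂ) ^ 3 * eulerFn 4 τ ^ 2 * eulerFn 32 τ ^ 4) := by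
  have hE4 := eulerFn_ne_zero (by norm_num : 0 < 4) τ
  have hE32 := eulerFn_ne_zero (by norm_num : 0 < 32) τ
  have hq := qParam_ne_zero τ
  rw [etaQuotient_eq_cexp_mul_prod, show Nat.divisors 32 = {1, 2, 4, 8, 16, 32} by decide]
  have hsum : (∑ δ ∈ ({1, 2, 4, 8, 16, 32} : Finset ℕ),
      (δ : ℤ) * expFn [(4, -2), (8, 4), (16, 2), (32, -4)] δ) = (-(24 * 3 : ℕ) : ℤ) := by decide
  rw [hsum, cexp_neg_eq_inv_qParam_pow]
  rw [Finset.prod_insert (by decide), Finset.prod_insert (by decide), Finset.prod_insert (by decide),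
    Finset.prod_insert (by decide), Finset.prod_insert (by decide), Finset.prod_singleton]
  rw [show expFn [(4, -2), (8, 4), (16, 2), (32, -4)] 1 = 0 by decide,
    show expFn [(4, -2), (8, 4), (16, 2), (32, -4)] 2 = 0 by decide,
    show expFn [(4, -2), (8, 4), (16, 2), (32, -4)] 4 = -2 by decide,
    show expFn [(4, -2), (8, 4), (16, 2), (32, -4)] 8 = 4 by decide,
    show expFn [(4, -2), (8, 4), (16, 2), (32, -4)] 16 = 2 by decide,
    show expFn [(4, -2), (8, 4), (16, 2), (32, -4)] 32 = -4 by decide]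
  simp only [zpow_neg, zpow_ofNat]
  field_simp

/-- **`φ₃₂ = η(4τ)²η(8τ)² = q E₄² E₈²`.** [folklore] -/
theorem etaProductThirtyTwo_eq (τ : ℍ) :
    cuspFormEtaProductThirtyTwo τ
      = Function.Periodic.qParam 1 (τ : ℂ) * eulerFn 4 τ ^ 2 * eulerFn 8 τ ^ 2 := by
  rw [show (cuspFormEtaProductThirtyTwo τ : ℂ) = etaProductThirtyTwo τ from rfl,
    etaProductThirtyTwo_apply]
  have h4 := eta_natMul_eq_qParam_mul_eulerFn 4 τ
  have h8 := eta_natMul_eq_qParam_mul_eulerFn 8 τ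
  push_cast at h4 h8
  rw [h4, h8]
  have hq : Function.Periodic.qParam 24 (4 * (τ : ℂ)) ^ 2 * Function.Periodic.qParam 24 (8 * (τ : ℂ)) ^ 2
      = Function.Periodic.qParam 1 (τ : ℂ) := by
    simp only [Function.Periodic.qParam, ← Complex.exp_nat_mul, ← Complex.exp_add]
    congr 1
    push_cast
    ring
  rw [← hq]
  ring

/-! ## 3. The derivatives of `X₃₂` and `Y₃₂` -/

/-- **`X₃₂′ = X₃₂ · (6E₁₆′/E₁₆ − 2·2πi − 2E₈′/E₈ − 4E₃₂′/E₃₂)`.** [folklore] -/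
theorem deriv_X32 (τ : ℍ) :
    deriv (etaQuotient 32 (expFn [(8, -2), (16, 6), (32, -4)]) ∘ ofComplex) τ
      = eulerFn 16 τ ^ 6 / (Function.Periodic.qParam 1 (τ : ℂ) ^ 2 * eulerFn 8 τ ^ 2 * eulerFn 32 τ ^ 4)
        * (6 * deriv (eulerFn 16 ∘ ofComplex) τ / eulerFn 16 τ - 2 * (2 * π * I)
          - 2 * deriv (eulerFn 8 ∘ ofComplex) τ / eulerFn 8 τ
          - 4 * deriv (eulerFn 32 ∘ ofComplex) τ / eulerFn 32 τ) := by
  have hE8 := eulerFn_ne_zero (by norm_num : 0 < 8) τ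
  have hE16 := eulerFn_ne_zero (by norm_num : 0 < 16) τ
  have hE32 := eulerFn_ne_zero (by norm_num : 0 < 32) τ
  have hq := qParam_ne_zero τ
  have hfun : (etaQuotient 32 (expFn [(8, -2), (16, 6), (32, -4)]) ∘ ofComplex) =ᶠ[𝓝 (τ : ℂ)]
      fun z ↦ (eulerFn 16 ∘ ofComplex) z ^ 6 / (Function.Periodic.qParam 1 z ^ 2
        * (eulerFn 8 ∘ ofComplex) z ^ 2 * (eulerFn 32 ∘ ofComplex) z ^ 4) := by
    filter_upwards [isOpen_upperHalfPlaneSet.mem_nhds τ.im_pos] with z hz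
    simp only [Function.comp_apply, X32_eq, ofComplex_apply_of_im_pos hz]
  rw [hfun.deriv_eq]
  have h8 := hasDerivAt_eulerFn_comp 8 τ
  have h16 := hasDerivAt_eulerFn_comp 16 τ
  have h32 := hasDerivAt_eulerFn_comp 32 τ
  have hqd : HasDerivAt (Function.Periodic.qParam 1) (2 * π * I * Function.Periodic.qParam 1 (τ : ℂ)) τ := by
    simpa using hasDerivAt_qParam 1 (τ : ℂ)
  have hden : Function.Periodic.qParam 1 (τ : ℂ) ^ 2 * (eulerFn 8 ∘ ofComplex) τ ^ 2
      * (eulerFn 32 ∘ ofComplex) τ ^ 4 ≠ 0 := by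
    simp only [Function.comp_apply, ofComplex_apply]
    exact mul_ne_zero (mul_ne_zero (pow_ne_zero _ hq) (pow_ne_zero _ hE8)) (pow_ne_zero _ hE32)
  have hD := (h16.fun_pow 6).fun_div (((hqd.fun_pow 2).fun_mul (h8.fun_pow 2)).fun_mul (h32.fun_pow 4)) hden
  rw [hD.deriv]
  simp only [Function.comp_apply, ofComplex_apply]
  field_simp
  ring

/-- **`Y₃₂′ = Y₃₂ · (4E₈′/E₈ + 2E₁₆′/E₁₆ − 3·2πi − 2E₄′/E₄ − 4E₃₂′/E₃₂)`.** [folklore] -/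
theorem deriv_Y32 (τ : ℍ) :
    deriv (etaQuotient 32 (expFn [(4, -2), (8, 4), (16, 2), (32, -4)]) ∘ ofComplex) τ
      = eulerFn 8 τ ^ 4 * eulerFn 16 τ ^ 2
          / (Function.Periodic.qParam 1 (τ : ℂ) ^ 3 * eulerFn 4 τ ^ 2 * eulerFn 32 τ ^ 4)
        * (4 * deriv (eulerFn 8 ∘ ofComplex) τ / eulerFn 8 τ
          + 2 * deriv (eulerFn 16 ∘ ofComplex) τ / eulerFn 16 τ - 3 * (2 * π * I)
          - 2 * deriv (eulerFn 4 ∘ ofComplex) τ / eulerFn 4 τ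
          - 4 * deriv (eulerFn 32 ∘ ofComplex) τ / eulerFn 32 τ) := by
  have hE4 := eulerFn_ne_zero (by norm_num : 0 < 4) τ
  have hE8 := eulerFn_ne_zero (by norm_num : 0 < 8) τ
  have hE16 := eulerFn_ne_zero (by norm_num : 0 < 16) τ
  have hE32 := eulerFn_ne_zero (by norm_num : 0 < 32) τ
  have hq := qParam_ne_zero τ
  have hfun : (etaQuotient 32 (expFn [(4, -2), (8, 4), (16, 2), (32, -4)]) ∘ ofComplex) =ᶠ[𝓝 (τ : ℂ)]
      fun z ↦ (eulerFn 8 ∘ ofComplex) z ^ 4 * (eulerFn 16 ∘ ofComplex) z ^ 2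
        / (Function.Periodic.qParam 1 z ^ 3 * (eulerFn 4 ∘ ofComplex) z ^ 2
          * (eulerFn 32 ∘ ofComplex) z ^ 4) := by
    filter_upwards [isOpen_upperHalfPlaneSet.mem_nhds τ.im_pos] with z hz
    simp only [Function.comp_apply, Y32_eq, ofComplex_apply_of_im_pos hz]
  rw [hfun.deriv_eq]
  have h4 := hasDerivAt_eulerFn_comp 4 τ
  have h8 := hasDerivAt_eulerFn_comp 8 τ
  have h16 := hasDerivAt_eulerFn_comp 16 τ
  have h32 := hasDerivAt_eulerFn_comp 32 τ
  have hqd : HasDerivAt (Function.Periodic.qParam 1) (2 * π * I * Function.Periodic.qParam 1 (τ : ℂ)) τ := by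
    simpa using hasDerivAt_qParam 1 (τ : ℂ)
  have hden : Function.Periodic.qParam 1 (τ : ℂ) ^ 3 * (eulerFn 4 ∘ ofComplex) τ ^ 2
      * (eulerFn 32 ∘ ofComplex) τ ^ 4 ≠ 0 := by
    simp only [Function.comp_apply, ofComplex_apply]
    exact mul_ne_zero (mul_ne_zero (pow_ne_zero _ hq) (pow_ne_zero _ hE4)) (pow_ne_zero _ hE32)
  have hD := ((h8.fun_pow 4).fun_mul (h16.fun_pow 2)).fun_div
    (((hqd.fun_pow 3).fun_mul (h4.fun_pow 2)).fun_mul (h32.fun_pow 4)) hden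
  rw [hD.deriv]
  simp only [Function.comp_apply, ofComplex_apply]
  field_simp
  ring

end Summit.BirchSwinnertonDyer.BirchSwinnertonDyer.Theorems.ManinLocalTwoThree.EulerRemaindersThirtyTwo

end
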